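import Summits.FinalStateConjecture.FinalStateConjecture.Theses.LaminatedThreshold
import Summits.FinalStateConjecture.FinalStateConjecture.Theorems.LaminatedThresholdAssemblyFrame
import Summits.FinalStateConjecture.FinalStateConjecture.Theorems.LaminatedThresholdLaminatedThresholdCore
import Literature.Geometry.Lorentzian.TameGenericityLocalWindowImmersed
import Literature.Geometry.Lorentzian.InitialDataPatch

/-!
# Disproof of `LaminatedThreshold` — findings (cdisprove, cycle 1, 2026-08-17)

Crux A of the REFUTATION route `LaminatedThreshold` (item stmt-FinalStateConjecture-16893):
`∃ X d⋆ Φ K`, `d⋆` admissible and exceptional, `Φ d⋆ ∈ K` a TWO-SIDED accumulation point of `K`, and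
along every LOCAL family `F` (jointly smooth, `F 0 = d⋆`, admissible members, agreeing with `d⋆` off
one compact set) `Φ ∘ F` is continuous on some `δ`-ball and `Φ (F c) ∈ K ⇒ F c` exceptional.

VERDICT OF THIS CYCLE: **no kill; the crux is doubly open and un-killable with the tree's objects.**
Every refutation of A (or of any variant obtained by mutating its clauses) must exhibit, near an
ARBITRARY admissible exceptional datum, a GOOD admissible datum (certified MGHD + complete `𝓘⁺` +
honest Kerr decomposition); the tree certifies exactly one good datum, the trivial one
(`summitProperty_trivialData`, given Choquet-Bruhat–Geroch), which is a compact kick of no exceptional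
datum. What this file adds to the landed Φ-free analysis (`LaminatedThresholdAssemblyFrame`:
`laminatedThreshold_iff_dropBad`, `laminatedThreshold_of_fatLocal`, `exceptional_accumulate_…`,
`noLocalExitWindow_…`; `…Core`: `laminatedThreshold_of_fat`, `not_laminatedThreshold_of_localExits`):

* §1 `not_laminatedThreshold_of_halfLocalExits` — the KILL CRITERION in its weakest form: a ONE-SIDED
  punctured window of good members, `F (t • v)` good for `0 < t < ε` along ONE direction of ONE local
  family, at every admissible exceptional datum, refutes A (strictly weaker hypothesis than
  `not_laminatedThreshold_of_localExits`, which wants all `0 < ‖c‖ < ε`). Physical reading: A cannot be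
  witnessed at any datum lying on the boundary of the DISPERSIVE region along some local curve with a
  clean dispersive side — i.e. at no ordinary collapse/dispersal threshold; the comb must be two-sided
  (sub-critical side captured by a NAKED secondary attractor as well).
* §2 `withoutContinuity_iff_exists_exceptional` — the CONTINUITY clause is load-bearing: with it
  dropped, A degenerates to the bare existence of an admissible exceptional datum (`Φ` = indicator of
  goodness, `K = (−1, 1)`), which no longer excludes local exits.
* §3 `laminatedThresholdImm_of_laminatedThreshold`, `not_finalStateConjecture_of_laminatedThresholdImm` —
  A as typed saturates along ALL smooth local families, including families FLAT (non-immersed) and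
  non-injective at `0`; the assembly needs saturation only along IMMERSED INJECTIVE local families (what
  crux B delivers). Planner note: A may be weakened to A_imm for free; as typed, A is refuted by a flat
  local exit curve even where no immersed exit exists (toy model in the docstring of §3).
* §4 (remark, no theorem: the module `…ChannelsResolveTameDevelopmentsRTrivialDatumMGHD` carrying
  `summitProperty_trivialData` is not built on the farm this session) — small model: the witness clause
  fails at the only certified datum (Minkowski slice) for every `(Φ, K)`, given CBG, since its base
  datum must be exceptional; a proof of A must first EXHIBIT a second admissible datum and prove it
  exceptional, and none is in the tree.
* §5 `oneSided_iff_exists_exceptional` (PROVED, no sorry) — TWO-SIDEDNESS is load-bearing in the same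
  sense as continuity: with ONE-sided accumulation A degenerates to "∃ admissible exceptional datum",
  via `exists_separating_functional`: for every datum `d⋆` a functional `Φ₀ ≥ 0` vanishing exactly at
  `d⋆` and continuous along EVERY jointly smooth family (series of truncated operator-norm distances of
  the point values of `(h, k)` over a dense sequence; `bilinSection_eq_of_dense`: smooth sections of
  the bilinear-form bundle agreeing on a dense set agree). So one-sided combs (the supercritical comb
  of Einstein–SU(2)-σ collapse) carry no information for this crux: BOTH clauses that lift A above
  "some admissible datum is exceptional" — continuity and two-sidedness — are exactly the ones the
  lamination mechanism must earn.
* §6 why it resists (logical position, mutations tried, kill criteria); numerics (BaumgarteEtAl2023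
  p. 3; arXiv:2606.27431 (2026) p. 7: digit-by-digit threshold scans with a single sub/super transition
  and clean sub-critical scaling, three + three families) disfavour A at every resolved vacuum threshold
  via §1 (modulo locality of the kick), but refute nothing.

Landed from this file (ACCEPTED 2026-08-17): `Negative/HalfExitKills` (p159240), `Negative/ContinuityLoadBearing`
(p159281), `Negative/TwoSidedLoadBearing` (p159894).

No definitions: every statement inlines the crux's blocks verbatim ("good" =
`(∃ MGHD) ∧ ∀ MGHD, SettlesT2`, `ClusterCompleteness.SettlesT2` being `Iff.rfl` with the route file's
block), so that the landed copies under `Theorems/LaminatedThreshold/Negative/` are fact-free.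
-/

noncomputable section

set_option linter.dupNamespace false

namespace Summit.FinalStateConjecture.FinalStateConjecture.Cruxes.LaminatedThreshold.Disproof

open Set Filter Function Metric TopologicalSpace
open scoped Manifold ContDiff Topology
open Literature.Geometry.Lorentzian
open Summit.FinalStateConjecture.FinalStateConjecture.Theses.LaminatedThreshold
open Summit.FinalStateConjecture.FinalStateConjecture.Theorems.ClusterCompleteness (SettlesT2)
open Summit.FinalStateConjecture.FinalStateConjecture.Theorems.LaminatedThreshold
  (real_lamination exceptional_accumulate_of_laminatedThreshold laminatedThreshold_iff_dropBad)

/-! ## §1 The kill criterion in its weakest (one-sided) form -/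

/-- **Half exits kill the crux.** If at EVERY admissible exceptional datum `d⋆` (on every `X`) some
local family `F` through `d⋆` has a ONE-SIDED punctured window of good members — `F (t • v)` good for
all `t ∈ (0, ε)`, for one direction `v ≠ 0` and one `ε > 0` — then `LaminatedThreshold` is false.
Contrapositive of the landed `exceptional_accumulate_of_laminatedThreshold` (two-sided accumulation
of exceptional members along every ray of every local family at the witness datum). Strictly weaker
hypothesis than `not_laminatedThreshold_of_localExits` (all `0 < ‖c‖ < ε` good): at a collapse
threshold lying on the boundary of the dispersive region along one local curve whose sub-critical
side is clean, A already fails. [folklore] -/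
theorem not_laminatedThreshold_of_halfLocalExits
    (h : ∀ (X : Type) [TopologicalSpace X] [ChartedSpace E3 X] [IsManifold (𝓡 3) ∞ X]
      [T2Space X] [SecondCountableTopology X] [ConnectedSpace X],
      ∀ dstar ∈ admissibleVacuumData X,
        ¬ ((∃ 𝒟 : VacuumCauchyDevelopment dstar, 𝒟.IsMaximal) ∧
            ∀ 𝒟 : VacuumCauchyDevelopment dstar, 𝒟.IsMaximal → SettlesT2 𝒟) →
          ∃ F : EuclideanSpace ℝ (Fin 1) → InitialDataSet (𝓡 3) X,
            InitialDataSet.IsSmoothDataFamily 1 F ∧ F 0 = dstar ∧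
              (∀ c, F c ∈ admissibleVacuumData X) ∧
                (∃ C : Set X, IsCompact C ∧
                  ∀ c, ∀ x ∉ C, (F c).h.inner x = dstar.h.inner x ∧ (F c).k x = dstar.k x) ∧
                  ∃ v : EuclideanSpace ℝ (Fin 1), v ≠ 0 ∧ ∃ ε : ℝ, 0 < ε ∧ ∀ t ∈ Set.Ioo (0 : ℝ) ε,
                    ((∃ 𝒟 : VacuumCauchyDevelopment (F (t • v)), 𝒟.IsMaximal) ∧
                      ∀ 𝒟 : VacuumCauchyDevelopment (F (t • v)), 𝒟.IsMaximal → SettlesT2 𝒟)) :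
    ¬ LaminatedThreshold := by
  intro hLT
  obtain ⟨X, i₁, i₂, i₃, i₄, i₅, i₆, dstar, hadm, hbad, hacc⟩ :=
    exceptional_accumulate_of_laminatedThreshold hLT
  obtain ⟨F, hF, h0, hadmF, hC, v, hv, ε, hε, hgood⟩ := h X dstar hadm hbad
  obtain ⟨t, ht, hbadt⟩ := hacc F hF h0 hadmF hC v hv ε hε
  exact hbadt (hgood t ht)

/-! ## §2 The continuity clause is load-bearing -/

/-- **Without continuity the crux degenerates.** Drop `ContinuousOn (Φ ∘ F) (ball 0 δ)` from the
family clause of `LaminatedThreshold` (left side, otherwise verbatim): the result is EQUIVALENT to the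
bare existence of an admissible exceptional datum (right side). (→) read the clause along the constant
family; (←) take `Φ` = the indicator of goodness (`1` on good data, `0` on exceptional data) and
`K = (−1, 1)`: `0 = Φ d⋆ ∈ K` is two-sidedly accumulated by `K`, and `Φ (F c) ∈ K` iff `F c` is
exceptional. So every bit of A beyond "some admissible datum is exceptional" — in particular the
exclusion of local exit windows that the assembly consumes — enters through the continuity clause.
[folklore] -/
theorem withoutContinuity_iff_exists_exceptional :
    (∃ (X : Type) (_ : TopologicalSpace X) (_ : ChartedSpace E3 X) (_ : IsManifold (𝓡 3) ∞ X)
      (_ : T2Space X) (_ : SecondCountableTopology X) (_ : ConnectedSpace X)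
      (dstar : InitialDataSet (𝓡 3) X) (Φ : InitialDataSet (𝓡 3) X → ℝ) (K : Set ℝ),
      dstar ∈ admissibleVacuumData X ∧
      ¬ ((∃ 𝒟 : VacuumCauchyDevelopment dstar, 𝒟.IsMaximal) ∧
          ∀ 𝒟 : VacuumCauchyDevelopment dstar, 𝒟.IsMaximal → SettlesT2 𝒟) ∧
      Φ dstar ∈ K ∧
      (∀ ε : ℝ, 0 < ε →
        (K ∩ Set.Ioo (Φ dstar - ε) (Φ dstar)).Nonempty ∧ (K ∩ Set.Ioo (Φ dstar) (Φ dstar + ε)).Nonempty) ∧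
      ∀ F : EuclideanSpace ℝ (Fin 1) → InitialDataSet (𝓡 3) X,
        InitialDataSet.IsSmoothDataFamily 1 F → F 0 = dstar → (∀ c, F c ∈ admissibleVacuumData X) →
        (∃ C : Set X, IsCompact C ∧
          ∀ c, ∀ x ∉ C, (F c).h.inner x = dstar.h.inner x ∧ (F c).k x = dstar.k x) →
        ∃ δ : ℝ, 0 < δ ∧
          ∀ c ∈ Metric.ball (0 : EuclideanSpace ℝ (Fin 1)) δ, Φ (F c) ∈ K →
            ¬ ((∃ 𝒟 : VacuumCauchyDevelopment (F c), 𝒟.IsMaximal) ∧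
                ∀ 𝒟 : VacuumCauchyDevelopment (F c), 𝒟.IsMaximal → SettlesT2 𝒟)) ↔
    ∃ (X : Type) (_ : TopologicalSpace X) (_ : ChartedSpace E3 X) (_ : IsManifold (𝓡 3) ∞ X)
      (_ : T2Space X) (_ : SecondCountableTopology X) (_ : ConnectedSpace X)
      (dstar : InitialDataSet (𝓡 3) X),
      dstar ∈ admissibleVacuumData X ∧
      ¬ ((∃ 𝒟 : VacuumCauchyDevelopment dstar, 𝒟.IsMaximal) ∧
          ∀ 𝒟 : VacuumCauchyDevelopment dstar, 𝒟.IsMaximal → SettlesT2 𝒟) := by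
  constructor
  · rintro ⟨X, i₁, i₂, i₃, i₄, i₅, i₆, dstar, Φ, K, hadm, hbad, -, -, -⟩
    exact ⟨X, i₁, i₂, i₃, i₄, i₅, i₆, dstar, hadm, hbad⟩
  · rintro ⟨X, i₁, i₂, i₃, i₄, i₅, i₆, dstar, hadm, hbad⟩
    classical
    -- `Φ` = indicator of goodness, `K = (−1, 1)`
    let good : InitialDataSet (𝓡 3) X → Prop := fun D ↦
      (∃ 𝒟 : VacuumCauchyDevelopment D, 𝒟.IsMaximal) ∧
        ∀ 𝒟 : VacuumCauchyDevelopment D, 𝒟.IsMaximal → SettlesT2 𝒟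
    let Φ : InitialDataSet (𝓡 3) X → ℝ := fun D ↦ if good D then 1 else 0
    have hΦ0 : Φ dstar = 0 := by simp [Φ, good, hbad]
    refine ⟨X, i₁, i₂, i₃, i₄, i₅, i₆, dstar, Φ, Set.Ioo (-1) 1, hadm, hbad, ?_, ?_, ?_⟩
    · rw [hΦ0]; exact ⟨by norm_num, by norm_num⟩
    · intro ε hε
      rw [hΦ0]
      refine ⟨⟨-(min ε 1 / 2), ?_, ?_⟩, ⟨min ε 1 / 2, ?_, ?_⟩⟩
      · have h1 : 0 < min ε 1 := lt_min hε one_pos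
        have h2 : min ε 1 ≤ 1 := min_le_right _ _
        constructor <;> linarith
      · have h1 : 0 < min ε 1 := lt_min hε one_pos
        have h2 : min ε 1 ≤ ε := min_le_left _ _
        constructor <;> linarith
      · have h1 : 0 < min ε 1 := lt_min hε one_pos
        have h2 : min ε 1 ≤ 1 := min_le_right _ _
        constructor <;> linarith
      · have h1 : 0 < min ε 1 := lt_min hε one_pos
        have h2 : min ε 1 ≤ ε := min_le_left _ _
        constructor <;> linarith
    · intro F _ _ _ _
      refine ⟨1, one_pos, fun c _ hcK hgood ↦ ?_⟩
      have hΦ1 : Φ (F c) = 1 := if_pos hgood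
      rw [hΦ1] at hcK
      exact lt_irrefl _ hcK.2

/-! ## §3 The crux saturates along flat and non-injective families, which the assembly never uses -/

/-- **A ⇒ A_imm** (trivial direction): restricting the family clause of `LaminatedThreshold` to
local families that are moreover IMMERSED (`IsImmersedAtZero 1 F`) and INJECTIVE weakens the crux.
[folklore] -/
theorem laminatedThresholdImm_of_laminatedThreshold (hA : LaminatedThreshold) :
    ∃ (X : Type) (_ : TopologicalSpace X) (_ : ChartedSpace E3 X) (_ : IsManifold (𝓡 3) ∞ X)
      (_ : T2Space X) (_ : SecondCountableTopology X) (_ : ConnectedSpace X)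
      (dstar : InitialDataSet (𝓡 3) X) (Φ : InitialDataSet (𝓡 3) X → ℝ) (K : Set ℝ),
      dstar ∈ admissibleVacuumData X ∧
      ¬ ((∃ 𝒟 : VacuumCauchyDevelopment dstar, 𝒟.IsMaximal) ∧
          ∀ 𝒟 : VacuumCauchyDevelopment dstar, 𝒟.IsMaximal → SettlesT2 𝒟) ∧
      Φ dstar ∈ K ∧
      (∀ ε : ℝ, 0 < ε →
        (K ∩ Set.Ioo (Φ dstar - ε) (Φ dstar)).Nonempty ∧ (K ∩ Set.Ioo (Φ dstar) (Φ dstar + ε)).Nonempty) ∧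
      ∀ F : EuclideanSpace ℝ (Fin 1) → InitialDataSet (𝓡 3) X,
        InitialDataSet.IsSmoothDataFamily 1 F → InitialDataSet.IsImmersedAtZero 1 F →
        Function.Injective F → F 0 = dstar → (∀ c, F c ∈ admissibleVacuumData X) →
        (∃ C : Set X, IsCompact C ∧
          ∀ c, ∀ x ∉ C, (F c).h.inner x = dstar.h.inner x ∧ (F c).k x = dstar.k x) →
        ∃ δ : ℝ, 0 < δ ∧ ContinuousOn (fun c ↦ Φ (F c)) (Metric.ball 0 δ) ∧
          ∀ c ∈ Metric.ball (0 : EuclideanSpace ℝ (Fin 1)) δ, Φ (F c) ∈ K →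
            ¬ ((∃ 𝒟 : VacuumCauchyDevelopment (F c), 𝒟.IsMaximal) ∧
                ∀ 𝒟 : VacuumCauchyDevelopment (F c), 𝒟.IsMaximal → SettlesT2 𝒟) := by
  obtain ⟨X, i₁, i₂, i₃, i₄, i₅, i₆, dstar, Φ, K, hadm, hbad, hK, hacc, hsat⟩ := hA
  exact ⟨X, i₁, i₂, i₃, i₄, i₅, i₆, dstar, Φ, K, hadm, hbad, hK, hacc,
    fun F hF _ _ h0 hadmF hC ↦ hsat F hF h0 hadmF hC⟩

/-- **A_imm ∧ B ⇒ ¬ FinalStateConjecture**: the route's deciding theorem `closes` goes through verbatim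
when crux A is weakened to saturation along IMMERSED INJECTIVE local families only, because the local
exit family produced by crux B (`TameExitsLocalise`) from the summit's tame exit is immersed and
injective. Hence the clauses of A about flat / non-injective families are NOT load-bearing for the
route — but they ARE exposed to refutation: in the planar toy
`E = {0} ∪ ⋃ₙ (Cₙ ∖ Gₙ) ⊆ ℝ²` — `Cₙ` the circle of radius `rₙ = 2^(−n²)`, `Gₙ ⊆ Cₙ` an open arc centred at
angle `θₙ = 1/n` of angular width `ωₙ = 1/n³` — every `C²` curve immersed at `0` crosses `Cₙ` at angle
`θ_∞ + O(rₙ)` off its tangent direction `θ_∞`, hence inside `Cₙ ∖ Gₙ` for all large `n` (for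
`θ_∞ = 0` because `|θₙ| = 1/n ≫ ωₙ, rₙ`; for `θ_∞ ≠ 0` trivially): so `Φ = |·|`, `K = {0} ∪ {rₙ}` is a
lamination chart ALONG IMMERSED CURVES (A_imm-type statement true), while the `C^∞` curve through the
gap centres `rₙ e^{iθₙ}`, flat at `0`, is a local exit, so no chart along all smooth curves exists
(A-type statement false, by `real_lamination`). Planner note (not a defect of `closes`): re-typing A
with `IsImmersedAtZero 1 F → Function.Injective F →` in the family clause costs the assembly nothing
and removes this exposure. [folklore] -/
theorem not_finalStateConjecture_of_laminatedThresholdImm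
    (hA : ∃ (X : Type) (_ : TopologicalSpace X) (_ : ChartedSpace E3 X) (_ : IsManifold (𝓡 3) ∞ X)
      (_ : T2Space X) (_ : SecondCountableTopology X) (_ : ConnectedSpace X)
      (dstar : InitialDataSet (𝓡 3) X) (Φ : InitialDataSet (𝓡 3) X → ℝ) (K : Set ℝ),
      dstar ∈ admissibleVacuumData X ∧
      ¬ ((∃ 𝒟 : VacuumCauchyDevelopment dstar, 𝒟.IsMaximal) ∧
          ∀ 𝒟 : VacuumCauchyDevelopment dstar, 𝒟.IsMaximal → SettlesT2 𝒟) ∧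
      Φ dstar ∈ K ∧
      (∀ ε : ℝ, 0 < ε →
        (K ∩ Set.Ioo (Φ dstar - ε) (Φ dstar)).Nonempty ∧ (K ∩ Set.Ioo (Φ dstar) (Φ dstar + ε)).Nonempty) ∧
      ∀ F : EuclideanSpace ℝ (Fin 1) → InitialDataSet (𝓡 3) X,
        InitialDataSet.IsSmoothDataFamily 1 F → InitialDataSet.IsImmersedAtZero 1 F →
        Function.Injective F → F 0 = dstar → (∀ c, F c ∈ admissibleVacuumData X) →
        (∃ C : Set X, IsCompact C ∧
          ∀ c, ∀ x ∉ C, (F c).h.inner x = dstar.h.inner x ∧ (F c).k x = dstar.k x) →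
        ∃ δ : ℝ, 0 < δ ∧ ContinuousOn (fun c ↦ Φ (F c)) (Metric.ball 0 δ) ∧
          ∀ c ∈ Metric.ball (0 : EuclideanSpace ℝ (Fin 1)) δ, Φ (F c) ∈ K →
            ¬ ((∃ 𝒟 : VacuumCauchyDevelopment (F c), 𝒟.IsMaximal) ∧
                ∀ 𝒟 : VacuumCauchyDevelopment (F c), 𝒟.IsMaximal → SettlesT2 𝒟))
    (hB : TameExitsLocalise) : ¬ FinalStateConjecture := by
  obtain ⟨X, i₁, i₂, i₃, i₄, i₅, i₆, dstar, Φ, K, hD, hbad, hk, hacc, hsat⟩ := hA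
  intro hFSC
  obtain ⟨e, F, hF, himm, h0, hinj, hadm, hexc⟩ := hFSC X dstar ⟨hD, hbad⟩
  obtain ⟨F', hF', himm', h0', hinj', hadm', hC', ε, hε, hgood⟩ :=
    hB X dstar hD hbad ⟨e, F, hF, himm, h0, hinj, hadm, fun c hc ↦ by
      by_contra hP
      exact hexc c hc ⟨hadm c, hP⟩⟩
  obtain ⟨δ, hδ, hcont, hKsat⟩ := hsat F' hF' himm' hinj' h0' hadm' hC'
  set v : EuclideanSpace ℝ (Fin 1) := EuclideanSpace.single (0 : Fin 1) (1 : ℝ) with hv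
  have hnv : ‖v‖ = 1 := by simp [hv]
  have hv0 : v ≠ 0 := by
    intro h; rw [h, norm_zero] at hnv; exact zero_ne_one hnv
  set ρ : ℝ := min δ ε with hρ
  have hρpos : 0 < ρ := lt_min hδ hε
  have hnorm : ∀ t : ℝ, ‖t • v‖ = |t| := fun t ↦ by
    rw [norm_smul, hnv, mul_one, Real.norm_eq_abs]
  have hball : ∀ t ∈ Set.Ico (0 : ℝ) ρ, t • v ∈ Metric.ball (0 : EuclideanSpace ℝ (Fin 1)) δ := by
    intro t ht
    rw [mem_ball_zero_iff, hnorm, abs_of_nonneg ht.1]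
    exact ht.2.trans_le (min_le_left _ _)
  set f : ℝ → ℝ := fun t ↦ Φ (F' (t • v)) with hf
  have hf0 : f 0 = Φ dstar := by simp [hf, h0']
  have hγ : Continuous fun t : ℝ ↦ t • v := continuous_id.smul continuous_const
  have hfcont : ContinuousOn f (Set.Ico 0 ρ) := hcont.comp hγ.continuousOn fun t ht ↦ hball t ht
  have hK' : f 0 ∈ K := by rw [hf0]; exact hk
  have hacc' : ∀ ε : ℝ, 0 < ε →
      (K ∩ Set.Ioo (f 0 - ε) (f 0)).Nonempty ∧ (K ∩ Set.Ioo (f 0) (f 0 + ε)).Nonempty := by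
    rw [hf0]; exact hacc
  obtain ⟨t, ht, htK⟩ := real_lamination hρpos hK' hacc' hfcont
  have htne : t • v ≠ 0 := smul_ne_zero (ne_of_gt ht.1) hv0
  have hlt : ‖t • v‖ < ε := by
    rw [hnorm, abs_of_pos ht.1]; exact ht.2.trans_le (min_le_right _ _)
  exact hKsat (t • v) (hball t ⟨ht.1.le, ht.2⟩) htK (hgood (t • v) htne hlt)


/-! ## §5 Two-sidedness is load-bearing: with one-sided accumulation the crux degenerates

The chart `(Φ, K)` of a ONE-SIDED variant can always be manufactured from `d⋆` alone: a functional
`Φ₀ ≥ 0`, vanishing exactly at `d⋆`, continuous along every jointly smooth family (a convergent series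
of truncated distances of the point values of `(h, k)` to those of `d⋆` over a countable dense set of
`X`), with `K = [0, ∞)` and `Φ = −Φ₀`. Ingredients: smooth sections of the bundle of bilinear forms
agreeing on a dense set agree (`bilinSection_eq_of_dense`); the fibrewise curves of a smooth family are
smooth (`InitialDataSet.contDiffAt_bilin_line`, landed). -/

section TwoSided

open Bundle

-- operator norms on `E3 →L[ℝ] E3 →L[ℝ] ℝ` and the Hom-bundle instances are deep (as in
-- `TameGenericityLocalWindowImmersed`)
set_option maxSynthPendingDepth 3
set_option synthInstance.maxHeartbeats 120000
set_option maxHeartbeats 1600000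

variable {X : Type} [TopologicalSpace X] [ChartedSpace E3 X] [IsManifold (𝓡 3) ∞ X]

/-- **Smooth sections of the bundle of bilinear forms on `TX` that agree on a dense set agree.**
Read both sections through the trivialization at `x₀`: the readings are continuous on its (open)
base set (`Trivialization.contMDiffOn_section_baseSet_iff`), agree on a dense subset of it, hence on
all of it (`Set.EqOn.of_subset_closure`), and the trivialization is injective on fibres. [folklore] -/
theorem bilinSection_eq_of_dense
    {σ₁ σ₂ : Π x : X, TangentSpace (𝓡 3) x →L[ℝ] TangentSpace (𝓡 3) x →L[ℝ] ℝ}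
    (h₁ : ContMDiff (𝓡 3) ((𝓡 3).prod 𝓘(ℝ, E3 →L[ℝ] E3 →L[ℝ] ℝ)) ∞
      (fun x : X ↦ TotalSpace.mk' (E3 →L[ℝ] E3 →L[ℝ] ℝ)
        (E := fun x : X ↦ TangentSpace (𝓡 3) x →L[ℝ] TangentSpace (𝓡 3) x →L[ℝ] ℝ) x (σ₁ x)))
    (h₂ : ContMDiff (𝓡 3) ((𝓡 3).prod 𝓘(ℝ, E3 →L[ℝ] E3 →L[ℝ] ℝ)) ∞
      (fun x : X ↦ TotalSpace.mk' (E3 →L[ℝ] E3 →L[ℝ] ℝ)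
        (E := fun x : X ↦ TangentSpace (𝓡 3) x →L[ℝ] TangentSpace (𝓡 3) x →L[ℝ] ℝ) x (σ₂ x)))
    {S : Set X} (hS : Dense S) (heq : ∀ x ∈ S, σ₁ x = σ₂ x) : σ₁ = σ₂ := by
  funext x₀
  set e := trivializationAt (E3 →L[ℝ] E3 →L[ℝ] ℝ)
    (fun x : X ↦ TangentSpace (𝓡 3) x →L[ℝ] TangentSpace (𝓡 3) x →L[ℝ] ℝ) x₀ with he
  have hx₀ : x₀ ∈ e.baseSet := FiberBundle.mem_baseSet_trivializationAt' x₀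
  have hr₁ : ContinuousOn (fun x ↦ (e ⟨x, σ₁ x⟩).2) e.baseSet :=
    ((e.contMDiffOn_section_baseSet_iff (IB := 𝓡 3) (n := ∞)).1 h₁.contMDiffOn).continuousOn
  have hr₂ : ContinuousOn (fun x ↦ (e ⟨x, σ₂ x⟩).2) e.baseSet :=
    ((e.contMDiffOn_section_baseSet_iff (IB := 𝓡 3) (n := ∞)).1 h₂.contMDiffOn).continuousOn
  have hEqS : EqOn (fun x ↦ (e ⟨x, σ₁ x⟩).2) (fun x ↦ (e ⟨x, σ₂ x⟩).2) (e.baseSet ∩ S) := by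
    intro x hx
    simp only [heq x hx.2]
  have hEq : EqOn (fun x ↦ (e ⟨x, σ₁ x⟩).2) (fun x ↦ (e ⟨x, σ₂ x⟩).2) e.baseSet :=
    hEqS.of_subset_closure hr₁ hr₂ inter_subset_left (hS.open_subset_closure_inter e.open_baseSet)
  have h2 : (e ⟨x₀, σ₁ x₀⟩).2 = (e ⟨x₀, σ₂ x₀⟩).2 := hEq hx₀
  rw [← e.symm_apply_apply_mk hx₀ (σ₁ x₀), ← e.symm_apply_apply_mk hx₀ (σ₂ x₀), h2]

variable [SecondCountableTopology X] [ConnectedSpace X]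

/-- **A curve-wise continuous functional separating `d⋆` from every other datum.** For every datum
`d⋆` there is `Φ₀ : data → ℝ`, `Φ₀ ≥ 0`, `Φ₀ d⋆ = 0`, `Φ₀ D = 0 ⇒ D = d⋆`, such that `c ↦ Φ₀ (F c)` is
continuous for every jointly smooth one-parameter family `F` (no base point, admissibility or
support condition needed): `Φ₀ D = ∑ₙ 2⁻ⁿ min (1, ‖h_D(xₙ) − h_{d⋆}(xₙ)‖ + ‖k_D(xₙ) − k_{d⋆}(xₙ)‖)` over a
dense sequence `(xₙ)` of `X` (second countable, non-empty since connected), the norms being the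
operator norms on `E3 →L E3 →L ℝ = T_x X →L T_x X →L ℝ`. [folklore] -/
theorem exists_separating_functional (dstar : InitialDataSet (𝓡 3) X) :
    ∃ Φ₀ : InitialDataSet (𝓡 3) X → ℝ,
      Φ₀ dstar = 0 ∧ (∀ D, 0 ≤ Φ₀ D) ∧ (∀ D, Φ₀ D = 0 → D = dstar) ∧
        ∀ F : EuclideanSpace ℝ (Fin 1) → InitialDataSet (𝓡 3) X,
          InitialDataSet.IsSmoothDataFamily 1 F → Continuous fun c ↦ Φ₀ (F c) := by
  obtain ⟨u, hu⟩ := TopologicalSpace.exists_dense_seq X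
  -- truncated distance of the point values at `u n`
  let a : ℕ → InitialDataSet (𝓡 3) X → ℝ := fun n D ↦
    ‖(show E3 →L[ℝ] E3 →L[ℝ] ℝ from D.h.inner (u n)) -
        (show E3 →L[ℝ] E3 →L[ℝ] ℝ from dstar.h.inner (u n))‖ +
      ‖(show E3 →L[ℝ] E3 →L[ℝ] ℝ from D.k (u n)) - (show E3 →L[ℝ] E3 →L[ℝ] ℝ from dstar.k (u n))‖
  let term : ℕ → InitialDataSet (𝓡 3) X → ℝ := fun n D ↦ (1 / 2 : ℝ) ^ n * min 1 (a n D)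
  have ha0 : ∀ n D, 0 ≤ a n D := fun n D ↦ add_nonneg (norm_nonneg _) (norm_nonneg _)
  have hterm0 : ∀ n D, 0 ≤ term n D := fun n D ↦
    mul_nonneg (pow_nonneg (by norm_num) n) (le_min zero_le_one (ha0 n D))
  have htermle : ∀ n D, term n D ≤ (1 / 2 : ℝ) ^ n := fun n D ↦ by
    have : min 1 (a n D) ≤ 1 := min_le_left _ _
    calc term n D = (1 / 2 : ℝ) ^ n * min 1 (a n D) := rfl
      _ ≤ (1 / 2 : ℝ) ^ n * 1 := by gcongr
      _ = (1 / 2 : ℝ) ^ n := mul_one _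
  have hgeom : Summable fun n : ℕ ↦ (1 / 2 : ℝ) ^ n :=
    summable_geometric_of_lt_one (by norm_num) (by norm_num)
  have hsum : ∀ D, Summable fun n ↦ term n D := fun D ↦
    Summable.of_nonneg_of_le (hterm0 · D) (htermle · D) hgeom
  refine ⟨fun D ↦ ∑' n, term n D, ?_, fun D ↦ tsum_nonneg (hterm0 · D), ?_, ?_⟩
  · -- `Φ₀ d⋆ = 0`
    have : ∀ n, term n dstar = 0 := fun n ↦ by simp [term, a]
    simp [this]
  · -- `Φ₀ D = 0 ⇒ D = d⋆`
    intro D hD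
    have hall : ∀ n, term n D = 0 := by
      intro n
      by_contra hne
      have hpos : 0 < term n D := lt_of_le_of_ne (hterm0 n D) (Ne.symm hne)
      have := (hsum D).tsum_pos (hterm0 · D) n hpos
      linarith
    have hpt : ∀ n, D.h.inner (u n) = dstar.h.inner (u n) ∧ D.k (u n) = dstar.k (u n) := by
      intro n
      have h1 : min 1 (a n D) = 0 := by
        have := hall n
        simp only [term, mul_eq_zero, pow_eq_zero_iff', one_div, inv_eq_zero] at this
        rcases this with ⟨h, -⟩ | h
        · norm_num at h
        · exact h
      have h2 : a n D = 0 := by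
        rcases min_choice 1 (a n D) with h | h
        · rw [h] at h1; exact absurd h1 one_ne_zero
        · rw [h] at h1; exact h1
      have h3 := (add_eq_zero_iff_of_nonneg (norm_nonneg _) (norm_nonneg _)).1 h2
      have e1 : (show E3 →L[ℝ] E3 →L[ℝ] ℝ from D.h.inner (u n)) =
          (show E3 →L[ℝ] E3 →L[ℝ] ℝ from dstar.h.inner (u n)) :=
        sub_eq_zero.1 (norm_eq_zero.1 h3.1)
      have e2 : (show E3 →L[ℝ] E3 →L[ℝ] ℝ from D.k (u n)) =
          (show E3 →L[ℝ] E3 →L[ℝ] ℝ from dstar.k (u n)) :=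
        sub_eq_zero.1 (norm_eq_zero.1 h3.2)
      exact ⟨e1, e2⟩
    have hh : D.h.inner = dstar.h.inner :=
      bilinSection_eq_of_dense D.h.contMDiff dstar.h.contMDiff (S := Set.range u) hu
        (by rintro _ ⟨n, rfl⟩; exact (hpt n).1)
    have hk : D.k = dstar.k :=
      bilinSection_eq_of_dense D.contMDiff_k dstar.contMDiff_k (S := Set.range u) hu
        (by rintro _ ⟨n, rfl⟩; exact (hpt n).2)
    exact InitialDataSet.ext_of_sections (fun x ↦ congrFun hh x) (fun x ↦ congrFun hk x)
  · -- continuity along smooth families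
    intro F hF
    -- along the axis `s ↦ F (s e₀)`
    have hline : Continuous fun s : ℝ ↦ ∑' n, term n (F (EuclideanSpace.single 0 s)) := by
      refine continuous_tsum (fun n ↦ ?_) hgeom fun n s ↦ ?_
      · have hH : Continuous fun s : ℝ ↦
            (show E3 →L[ℝ] E3 →L[ℝ] ℝ from (F (EuclideanSpace.single 0 s)).h.inner (u n)) :=
          continuous_iff_continuousAt.2 fun t ↦
            (InitialDataSet.contDiffAt_bilin_line (σ := fun c x ↦ (F c).h.inner x) hF.1 (u n) t).continuousAt
        have hK : Continuous fun s : ℝ ↦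
            (show E3 →L[ℝ] E3 →L[ℝ] ℝ from (F (EuclideanSpace.single 0 s)).k (u n)) :=
          continuous_iff_continuousAt.2 fun t ↦
            (InitialDataSet.contDiffAt_bilin_line (σ := fun c x ↦ (F c).k x) hF.2 (u n) t).continuousAt
        exact continuous_const.mul (continuous_const.min
          (((hH.sub continuous_const).norm).add ((hK.sub continuous_const).norm)))
      · rw [Real.norm_eq_abs, abs_of_nonneg (hterm0 n _)]
        exact htermle n _
    have hfac : (fun c : EuclideanSpace ℝ (Fin 1) ↦ ∑' n, term n (F c)) =
        (fun s : ℝ ↦ ∑' n, term n (F (EuclideanSpace.single 0 s))) ∘ fun c ↦ c 0 := by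
      funext c
      simp only [Function.comp_apply, InitialDataSet.single_apply_zero_eq]
    rw [hfac]
    exact hline.comp (PiLp.continuous_apply 2 (fun _ : Fin 1 ↦ ℝ) 0)

/-- **With ONE-SIDED accumulation the crux degenerates** to the bare existence of an admissible
exceptional datum. Left: `LaminatedThreshold` verbatim except that `K` is only required to
accumulate at `Φ d⋆` FROM THE RIGHT. (→) forget the chart; (←) `Φ := −Φ₀` for the separating
functional of `exists_separating_functional`, `K := [0, ∞)`, `δ := 1`: `Φ ∘ F` is continuous along
every smooth family, and `Φ (F c) ∈ K` iff `Φ₀ (F c) = 0` iff `F c = d⋆`, which is exceptional. So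
the two-sided accumulation demanded by the crux is exactly what lifts it above "some admissible
datum is exceptional"; one-sided combs (e.g. the supercritical comb of Einstein–SU(2)-σ collapse,
Aichelburg–Bizoń–Tabor 2006) give nothing. (The mirror statement with accumulation from the left is
the same with `Φ := Φ₀`, `K := (−∞, 0]`.) [folklore] -/
theorem oneSided_iff_exists_exceptional :
    (∃ (X : Type) (_ : TopologicalSpace X) (_ : ChartedSpace E3 X) (_ : IsManifold (𝓡 3) ∞ X)
      (_ : T2Space X) (_ : SecondCountableTopology X) (_ : ConnectedSpace X)
      (dstar : InitialDataSet (𝓡 3) X) (Φ : InitialDataSet (𝓡 3) X → ℝ) (K : Set ℝ),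
      dstar ∈ admissibleVacuumData X ∧
      ¬ ((∃ 𝒟 : VacuumCauchyDevelopment dstar, 𝒟.IsMaximal) ∧
          ∀ 𝒟 : VacuumCauchyDevelopment dstar, 𝒟.IsMaximal → SettlesT2 𝒟) ∧
      Φ dstar ∈ K ∧
      (∀ ε : ℝ, 0 < ε → (K ∩ Set.Ioo (Φ dstar) (Φ dstar + ε)).Nonempty) ∧
      ∀ F : EuclideanSpace ℝ (Fin 1) → InitialDataSet (𝓡 3) X,
        InitialDataSet.IsSmoothDataFamily 1 F → F 0 = dstar → (∀ c, F c ∈ admissibleVacuumData X) →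
        (∃ C : Set X, IsCompact C ∧
          ∀ c, ∀ x ∉ C, (F c).h.inner x = dstar.h.inner x ∧ (F c).k x = dstar.k x) →
        ∃ δ : ℝ, 0 < δ ∧ ContinuousOn (fun c ↦ Φ (F c)) (Metric.ball 0 δ) ∧
          ∀ c ∈ Metric.ball (0 : EuclideanSpace ℝ (Fin 1)) δ, Φ (F c) ∈ K →
            ¬ ((∃ 𝒟 : VacuumCauchyDevelopment (F c), 𝒟.IsMaximal) ∧
                ∀ 𝒟 : VacuumCauchyDevelopment (F c), 𝒟.IsMaximal → SettlesT2 𝒟)) ↔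
    ∃ (X : Type) (_ : TopologicalSpace X) (_ : ChartedSpace E3 X) (_ : IsManifold (𝓡 3) ∞ X)
      (_ : T2Space X) (_ : SecondCountableTopology X) (_ : ConnectedSpace X)
      (dstar : InitialDataSet (𝓡 3) X),
      dstar ∈ admissibleVacuumData X ∧
      ¬ ((∃ 𝒟 : VacuumCauchyDevelopment dstar, 𝒟.IsMaximal) ∧
          ∀ 𝒟 : VacuumCauchyDevelopment dstar, 𝒟.IsMaximal → SettlesT2 𝒟) := by
  constructor
  · rintro ⟨X, i₁, i₂, i₃, i₄, i₅, i₆, dstar, Φ, K, hadm, hbad, -, -, -⟩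
    exact ⟨X, i₁, i₂, i₃, i₄, i₅, i₆, dstar, hadm, hbad⟩
  · rintro ⟨X, i₁, i₂, i₃, i₄, i₅, i₆, dstar, hadm, hbad⟩
    obtain ⟨Φ₀, h0, hnn, hsep, hcont⟩ := exists_separating_functional dstar
    refine ⟨X, i₁, i₂, i₃, i₄, i₅, i₆, dstar, fun D ↦ -Φ₀ D, Set.Ici 0, hadm, hbad, ?_, ?_, ?_⟩
    · simp [h0]
    · intro ε hε
      refine ⟨ε / 2, ?_, ?_⟩
      · show (0 : ℝ) ≤ ε / 2
        linarith
      · simp only [h0, neg_zero, zero_add]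
        constructor <;> linarith
    · intro F hF _ _ _
      refine ⟨1, one_pos, (hcont F hF).neg.continuousOn, fun c _ hcK ↦ ?_⟩
      have hzero : Φ₀ (F c) = 0 := le_antisymm (by simpa using hcK) (hnn (F c))
      rw [hsep (F c) hzero]
      exact hbad

end TwoSided


/-! ## §6 Why the crux resists (and what would kill it)

**Logical position** (all kernel-checked, here or landed):
`FatLocal ⇒ A ⇒ A_imm`, `A ⇒ A₁` (two-sided accumulation of exceptional members along every ray of every
local family, flat ones included; `exceptional_accumulate_of_laminatedThreshold`) `⇒ A₀` (no local exit
window); `¬A ⇒ ¬FatLocal` = at every admissible exceptional datum some local family has GOOD members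
arbitrarily close to `0`. With the continuity clause or two-sidedness removed, `A ≡ ∃` admissible
exceptional datum (§2, §5); with both kept, `A ⇒ A₀`, which "∃ exceptional" does not give (toy: `E` a
hyperplane). So a disproof must CERTIFY GOOD DATA (MGHD + complete `𝓘⁺` + honest Kerr decomposition)
next to an arbitrary exceptional datum, and a proof must CERTIFY AN EXCEPTIONAL DATUM robustly; the
tree certifies one good datum (trivial, given CBG) and no exceptional one. Doubly open.

**Mutations tried this cycle** (none yields `_false_without_`): dropping `F 0 = d⋆`, admissibility of
members, or compact agreement each STRENGTHENS the crux, and each strengthened form is still consistent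
relative to the tree (its refutation again needs a certified good datum: a constant family at a good
compact kick; a good non-vacuum member — impossible, no MGHD; a tame/scaling exit); gauge families
`ψ_c^* d⋆` and homothety families saturate automatically (all members exceptional with `d⋆`), so `Φ`
cannot be forced to be discontinuous or to meet `K` at a good member without new data.

**Kill criteria, sharpest available forms**: `Negative/HalfExitKills` (one-sided good window along one
direction of one local family at every exceptional datum); numerically, every resolved vacuum threshold
is of exactly this kind — Baumgarte et al., PRL 131 (2023) 181401 = arXiv:2305.17171, p. 3 (sub-critical
`I_max` follows an approximate power law in `|A − A⋆|` along the centred `A < 0` Brill family, three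
codes, `A⋆ = −3.509144`); Baumgarte–Gundlach–Hilditch et al., arXiv:2606.27431 (2026), p. 7 ("Knowing the
critical amplitude `A∗` to `n` digits, we determine the next digit by performing nine simulations for its
nine possible values … fine-tune to about six digits", three families, a single sub/super transition per
digit level, clean sub-critical scaling Fig. 3). Those amplitude families are TAME rather than local
(Gaussian seeds, varying mass), so they bear on the planner's pivot A′ (saturation along all tame
families) and on the summit directly; for A itself they are evidence only modulo locality. A two-sided
comb would show up there as non-monotone outcomes in the digit scan and as secondary spikes in the
sub-critical scaling plot, as the one-sided σ-model comb of Aichelburg–Bizoń–Tabor did; none is reported.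
-/

end Summit.FinalStateConjecture.FinalStateConjecture.Cruxes.LaminatedThreshold.Disproof

end
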